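import Literature.AnabelianGeometry.SemiGraphs.TemperedDeltaNormalizers
import Literature.AnabelianGeometry.SemiGraphs.TemperedCommensurablyTerminal
import HarnessLib

/-!
# `Δ^temp_X` is commensurably terminal in `Δ_X`, from the virtually free tower

Mochizuki, *Semi-graphs of anabelioids*, Publ. RIMS **42** (2006) [SemiAnbd], §6 Lemma 6.1 (ii) p. 69
("`N_{Δ_X}(Δ^temp_X) = Δ^temp_X`"), sharpened to commensurable terminality as in [IUTchI] Prop. 2.4 (iii)
p. 50 ("`Δ^tp_X` is commensurably terminal in `Δ̂_X`"). [cite: MochizukiSemiAnbd2006, Lem 6.1(ii) p.69]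

PROOF-ONLY file (abc-iut cell, prover abc-iut-w5-d240; no definitions): the `Δ`-companion of
`TemperedCurve.isCommensurablyTerminal_range_toHat_of_tower` (`TemperedCommensurablyTerminal.lean`),
for a datum with group-level parameters `d : X.GroupLevelData`, consuming BY NAME abc-iut-w5-d139's
`isTempered_deltaTemp`, `isProfiniteCompletion_deltaToHat` and `deltaTemp_tower_of_tower`.  Classical;
nothing here concerns the disputed parts of inter-universal Teichmüller theory or takes a side on
[IUTchIII] Cor. 3.12; typed ≠ discharged.
-/

noncomputable section

namespace Literature.AnabelianGeometry.SemiGraphs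

open _root_.Topology
open Literature.AnabelianGeometry.AbsoluteAnabelian (IsCommensurablyTerminal)

namespace TemperedCurve

variable {p : ℕ} [Fact p.Prime] (X : TemperedCurve p)

/-- **`Δ^temp_X` is commensurably terminal in `Δ_X`** for a datum with group-level parameters
`d : X.GroupLevelData`, modulo the tower input for `Π^temp_{X_K}` (sharpens [SemiAnbd] Lem. 6.1 (ii)
`X.DeltaTempNormallyTerminal`; the `Δ`-clause of [IUTchI] Prop. 2.4 (iii) "`Δ^tp_X` is commensurably
terminal in `Δ̂_X`" in the §6 vocabulary). [cite: MochizukiSemiAnbd2006, Lem 6.1(ii) p.69] -/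
theorem isCommensurablyTerminal_range_deltaToHat_of_tower (d : X.GroupLevelData)
    (htower₀ : ∀ U ∈ 𝓝 (1 : X.PiTemp), ∃ N : OpenNormalSubgroup X.PiTemp, (N : Set X.PiTemp) ⊆ U ∧
      ∃ (G : Subgroup (X.PiTemp ⧸ N.toSubgroup)) (_ : IsFreeGroup G), G.Normal ∧ G.FiniteIndex ∧
        Finite (IsFreeGroup.Generators G) ∧ ∃ a ∈ G, ∃ b ∈ G, a * b ≠ b * a) :
    IsCommensurablyTerminal X.deltaToHat.toMonoidHom.range :=
  (X.isTempered_deltaTemp d).isCommensurablyTerminal_range X.deltaToHat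
    (X.isProfiniteCompletion_deltaToHat d) (X.deltaTemp_tower_of_tower d htower₀)

end TemperedCurve

end Literature.AnabelianGeometry.SemiGraphs

end
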